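import Summits.Parity.BatemanHorn.Theorems.SystemZeroRepulsion.Negative.StubFarMomentJunkModels
import Literature.Barriers.ABC.EpsilonCannotBeDroppedHolds

/-!
# Stub S1 `stub_farMoment` of line `smooth-rough-lattice-acquisition` — `irreducible` and `pairwise_not_associated` ARE load-bearing (primorial witness, prime number theorem)

Negative-side theorems (refuter, drefute gen 3, 2026-08-16) for the shared anatomy stub S1 = `FarMomentAlongSystem`
of the line `Cruxes/SystemZeroRepulsion/Lines/smooth-rough-lattice-acquisition.lean` (sha 5e06eb842271) of the crux
`Summit.Parity.BatemanHorn.Theses.AlmostPrimeZeros.SystemZeroRepulsion` (stmt-Parity-11291); also the anatomy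
input of card far-zone-hardy-ramanujan-along-f:

  S1  `∀ (k,f) BH, ∃ C, ∀ x ≥ 3, ∀ t ∈ [1, √log x], Σ_{n ≤ x} t^{s_f(n)} ≤ (x+1)·exp(C t log log x)`,
  `s_f(n) = Σ_i Σ_p min(v_p(f_i(n)), 2)` (typed through `Int.toNat`, `Nat.factorization`).

`StubFarMomentJunkModels.lean` (gen 2, p76776) showed that `leadingCoeff_pos` and `hasNoFixedPrimeDivisor` are NOT
load-bearing (the conclusion holds for `![-X]` and `![C 3]`). Here we complete the table: the two remaining fields
ARE load-bearing AS TYPED, because of the RANGE `t ≤ √log x`: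

* `stubFarMoment_false_without_irreducible` — witness `![X ^ 2]`;
* `stubFarMoment_false_without_pairwise_not_associated` — witness `![X, X]`.

In both cases the statistic at `n = x := primorial y = ∏_{p ≤ y} p` equals `2 π(y)` (`s(n²) = 2ω(n)`; `2 s(n)` with
`n` squarefree), so at the extreme tilt `t = √log x` the SINGLE term `n = x` of the sum is `t^{2π(y)} = (log x)^{π(y)} =
ϑ(y)^{π(y)}`, while the bound is `(x+1)e^{C√ϑ(y) log ϑ(y)} = e^{ϑ(y) + O(√y log y)}`.  By the prime number theorem
in the partial-summation form `π(y) log y − ϑ(y) ≥ (1−ε) y/log y` (tree: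
`Literature.Barriers.ABC.StewartTijdeman.eventually_primeCounting_mul_log_sub_theta_ge`) and `ϑ(y) ≥ (1−ε) y`
(`…eventually_theta_ge`), `π(y) log ϑ(y) ≥ ϑ(y) + ½ y/log y`, which beats `ϑ(y) + log 2 + C⁺√(2y) log(2y)` for
large `y` (`primorial_witness`).  Chebyshev's bounds alone do NOT suffice here: the margin `½ y/log y` lives at the
second order of `π(y) log y` versus `ϑ(y)`.

So the natural hypothesis class of S1 is: each `f_i` non-constant and `∏ f_i` squarefree (gen 2's remark, now
kernel-checked on the negative side); for `X²` / `(X, X)` the moment is `≍ x(log x)^{t²−1}`, incompatible with any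
`e^{C t log log x}` once `t → ∞`, and the primorial term alone already breaks the bound at `t = √log x`.
-/

noncomputable section

open Filter Polynomial Finset
open scoped Topology

namespace Summit.Parity.BatemanHorn.Theorems.SystemZeroRepulsion.Negative

open Literature.NumberTheory.Sieve
open Summit.Parity.BatemanHorn.Theorems.SystemLSDRealSegment.Negative
open Literature.Barriers.ABC Literature.Barriers.ABC.StewartTijdeman

/-! ## Elementary growth: `(log y)² √y = o(y)` in the explicit form used below -/

/-- `(log y)² / √y → 0` (from Mathlib's `log^n x / x → 0` composed with `√`). [folklore] -/
theorem tendsto_log_sq_div_sqrt :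
    Tendsto (fun y : ℝ => Real.log y ^ 2 / Real.sqrt y) atTop (𝓝 0) := by
  have h := ((Real.tendsto_pow_log_div_mul_add_atTop 1 0 2 one_ne_zero).comp
    Real.tendsto_sqrt_atTop).const_mul 4
  rw [mul_zero] at h
  refine h.congr' ?_
  filter_upwards [eventually_ge_atTop (0 : ℝ)] with y hy
  simp only [Function.comp_apply, one_mul, add_zero, Real.log_sqrt hy]
  ring

/-- For `K ≥ 0`, eventually `log 2 + K √(2y) log(2y) < y / (2 log y)`. [folklore] -/
theorem eventually_growth {K : ℝ} (hK : 0 ≤ K) :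
    ∀ᶠ y : ℝ in atTop, Real.log 2 + K * Real.sqrt (2 * y) * Real.log (2 * y) < y / (2 * Real.log y) := by
  have hδ : (0 : ℝ) < 1 / (3 + 9 * K) := by positivity
  filter_upwards [tendsto_log_sq_div_sqrt.eventually (gt_mem_nhds hδ), eventually_ge_atTop (3 : ℝ)]
    with y hy hy3
  have hy0 : 0 < y := by linarith
  have he3 : Real.exp 1 < 3 := lt_trans Real.exp_one_lt_d9 (by norm_num)
  have hlogy : 1 ≤ Real.log y := by
    rw [← Real.log_exp 1]
    exact Real.log_le_log (Real.exp_pos 1) (he3.le.trans hy3)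
  have hlog2 : Real.log 2 < 1 := by have := Real.log_two_lt_d9; linarith
  have hlog2pos : 0 < Real.log 2 := Real.log_pos one_lt_two
  have hlog2y : Real.log (2 * y) ≤ 2 * Real.log y := by
    rw [Real.log_mul two_ne_zero hy0.ne']
    have : Real.log 2 ≤ Real.log y := by linarith
    linarith
  have hlog2y0 : 0 ≤ Real.log (2 * y) := Real.log_nonneg (by linarith)
  have hsqrt_pos : 0 < Real.sqrt y := Real.sqrt_pos.2 hy0
  have hsqrt1 : 1 ≤ Real.sqrt y := Real.one_le_sqrt.2 (by linarith)
  have hsq : Real.sqrt y * Real.sqrt y = y := Real.mul_self_sqrt hy0.le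
  -- `√(2y) ≤ 2 √y`
  have h2y : Real.sqrt (2 * y) ≤ 2 * Real.sqrt y := by
    calc Real.sqrt (2 * y) ≤ Real.sqrt (4 * y) := Real.sqrt_le_sqrt (by linarith)
      _ = Real.sqrt 4 * Real.sqrt y := Real.sqrt_mul (by norm_num) y
      _ = 2 * Real.sqrt y := by
          rw [show (4 : ℝ) = 2 ^ 2 by norm_num, Real.sqrt_sq (by norm_num : (0 : ℝ) ≤ 2)]
  -- `(log y)² √y ≤ δ y`
  have hmain : Real.log y ^ 2 * Real.sqrt y ≤ 1 / (3 + 9 * K) * y := by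
    have h1 : Real.log y ^ 2 < 1 / (3 + 9 * K) * Real.sqrt y := (div_lt_iff₀ hsqrt_pos).1 hy
    nlinarith [h1, hsqrt_pos]
  -- the product `(log 2 + K √(2y) log(2y)) · (2 log y)` is `< y`
  have hprod : (Real.log 2 + K * Real.sqrt (2 * y) * Real.log (2 * y)) * (2 * Real.log y) < y := by
    have hA : Real.log 2 * (2 * Real.log y) ≤ 2 * (Real.log y ^ 2 * Real.sqrt y) := by
      -- `log 2 ≤ 1 ≤ log y` and `√y ≥ 1`
      have : Real.log 2 * Real.log y ≤ Real.log y ^ 2 * Real.sqrt y := by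
        calc Real.log 2 * Real.log y ≤ Real.log y * Real.log y :=
              mul_le_mul_of_nonneg_right (by linarith) (by linarith)
          _ = Real.log y ^ 2 * 1 := by ring
          _ ≤ Real.log y ^ 2 * Real.sqrt y := mul_le_mul_of_nonneg_left hsqrt1 (by positivity)
      linarith
    have hB : K * Real.sqrt (2 * y) * Real.log (2 * y) * (2 * Real.log y) ≤
        8 * K * (Real.log y ^ 2 * Real.sqrt y) := by
      have h1 : Real.sqrt (2 * y) * Real.log (2 * y) ≤ (2 * Real.sqrt y) * (2 * Real.log y) :=
        mul_le_mul h2y hlog2y hlog2y0 (by positivity)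
      have h2 : K * (Real.sqrt (2 * y) * Real.log (2 * y)) * (2 * Real.log y) ≤
          K * ((2 * Real.sqrt y) * (2 * Real.log y)) * (2 * Real.log y) :=
        mul_le_mul_of_nonneg_right (mul_le_mul_of_nonneg_left h1 hK) (by linarith)
      calc K * Real.sqrt (2 * y) * Real.log (2 * y) * (2 * Real.log y)
          = K * (Real.sqrt (2 * y) * Real.log (2 * y)) * (2 * Real.log y) := by ring
        _ ≤ K * ((2 * Real.sqrt y) * (2 * Real.log y)) * (2 * Real.log y) := h2
        _ = 8 * K * (Real.log y ^ 2 * Real.sqrt y) := by ring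
    have hC : (2 + 8 * K) * (Real.log y ^ 2 * Real.sqrt y) ≤ (2 + 8 * K) * (1 / (3 + 9 * K) * y) :=
      mul_le_mul_of_nonneg_left hmain (by positivity)
    have hD : (2 + 8 * K) * (1 / (3 + 9 * K) * y) < y := by
      have h39 : (0 : ℝ) < 3 + 9 * K := by positivity
      rw [show (2 + 8 * K) * (1 / (3 + 9 * K) * y) = ((2 + 8 * K) / (3 + 9 * K)) * y by
        field_simp]
      have : (2 + 8 * K) / (3 + 9 * K) < 1 := by
        rw [div_lt_one h39]; linarith
      nlinarith
    calc (Real.log 2 + K * Real.sqrt (2 * y) * Real.log (2 * y)) * (2 * Real.log y)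
        = Real.log 2 * (2 * Real.log y) + K * Real.sqrt (2 * y) * Real.log (2 * y) * (2 * Real.log y) := by ring
      _ ≤ 2 * (Real.log y ^ 2 * Real.sqrt y) + 8 * K * (Real.log y ^ 2 * Real.sqrt y) := add_le_add hA hB
      _ = (2 + 8 * K) * (Real.log y ^ 2 * Real.sqrt y) := by ring
      _ < y := hC.trans_lt hD
  have h2log : 0 < 2 * Real.log y := by linarith
  exact (lt_div_iff₀ h2log).2 hprod

/-! ## The primorial witness -/

/-- **Primorial witness.** For every real `C` there is `y` with `x := primorial y ≥ 3`, `log x ≥ 1` and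
`(x + 1)·exp(C·√(log x)·log log x) < (√log x)^{2π(y)} (= (log x)^{π(y)})`.  With `ϑ(y) = log x`:
`π(y) log ϑ(y) ≥ π(y)(log y − 1/15) ≥ ϑ(y) + ¾·y/log y − (2/15)·y/log y ≥ ϑ(y) + ½·y/log y` (prime number theorem,
partial summation; `ϑ(y) ≥ (15/16) y`, `π(y) ≤ 2y/log y`), against `log(x+1) + C√ϑ log ϑ ≤ ϑ + log 2 + C⁺√(2y) log(2y)`
(`ϑ(y) ≤ y log 4 ≤ 2y`). [cite: MontgomeryVaughan2007, §8.1] -/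
theorem primorial_witness (C : ℝ) :
    ∃ y : ℕ, 3 ≤ primorial y ∧ 1 ≤ Real.log (primorial y : ℝ) ∧
      ((primorial y : ℝ) + 1) * Real.exp (C * Real.sqrt (Real.log (primorial y : ℝ)) *
          Real.log (Real.log (primorial y : ℝ))) <
        Real.sqrt (Real.log (primorial y : ℝ)) ^ (2 * Nat.primeCounting y) := by
  set K : ℝ := max C 0 with hKdef
  have hK0 : 0 ≤ K := le_max_right _ _
  have hCK : C ≤ K := le_max_left _ _
  have h1 := eventually_primeCounting_mul_log_sub_theta_ge (ε := 1 / 4) (by norm_num) (by norm_num)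
  have h2 := eventually_theta_ge (ε := 1 / 16) (by norm_num)
  have h3 := eventually_primeCounting_bounds (ε := 1) one_pos
  have h4 := eventually_growth hK0
  have hall := (h1.and (h2.and (h3.and h4))).and (eventually_ge_atTop (16 : ℝ))
  obtain ⟨y, ⟨hy1, hy2, hy3, hy4⟩, hy16⟩ := ((tendsto_natCast_atTop_atTop (R := ℝ)).eventually hall).exists
  simp only [Nat.floor_natCast] at hy1 hy3
  refine ⟨y, ?_⟩
  -- notation
  set θv : ℝ := Chebyshev.theta (y : ℝ) with hθv
  set m : ℕ := Nat.primeCounting y with hm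
  have hx0 : (0 : ℝ) < (primorial y : ℝ) := by exact_mod_cast primorial_pos y
  have hθx : Real.log (primorial y : ℝ) = θv := by
    rw [hθv, Chebyshev.theta_eq_log_primorial, Nat.floor_natCast]
  have hy0 : (0 : ℝ) < y := by linarith
  have hlogy0 : 0 < Real.log (y : ℝ) := Real.log_pos (by linarith)
  -- size of `θ`
  have hθ15 : 15 ≤ θv := by linarith
  have hθ0 : 0 < θv := by linarith
  have hθ1 : 1 ≤ θv := by linarith
  have hlog2 : Real.log 2 < 1 := by have := Real.log_two_lt_d9; linarith
  have hθ2y : θv ≤ 2 * y := by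
    have h := Chebyshev.theta_le_log4_mul_x hy0.le
    have hlog4 : Real.log 4 ≤ 2 := by
      rw [show (4 : ℝ) = 2 ^ 2 by norm_num, Real.log_pow]; push_cast; linarith
    calc θv ≤ Real.log 4 * y := h
      _ ≤ 2 * y := mul_le_mul_of_nonneg_right hlog4 hy0.le
  -- `log θ ≥ log y − 1/15`
  have hlogθ : Real.log (y : ℝ) - 1 / 15 ≤ Real.log θv := by
    have h1516 : (15 / 16 : ℝ) * y ≤ θv := by linarith
    have hpos : (0 : ℝ) < 15 / 16 * y := by positivity
    have hle : Real.log (15 / 16 * (y : ℝ)) ≤ Real.log θv := Real.log_le_log hpos h1516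
    rw [Real.log_mul (by norm_num) hy0.ne'] at hle
    have h1615 : Real.log (16 / 15 : ℝ) ≤ 16 / 15 - 1 := Real.log_le_sub_one_of_pos (by norm_num)
    have hinv : Real.log (15 / 16 : ℝ) = -Real.log (16 / 15 : ℝ) := by
      rw [← Real.log_inv]; norm_num
    linarith
  -- `m log θ ≥ θ + y/(2 log y)`
  have hm0 : (0 : ℝ) ≤ m := Nat.cast_nonneg _
  have hmlogθ : θv + (y : ℝ) / (2 * Real.log y) ≤ (m : ℝ) * Real.log θv := by
    have hA : (m : ℝ) * (Real.log (y : ℝ) - 1 / 15) ≤ (m : ℝ) * Real.log θv :=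
      mul_le_mul_of_nonneg_left hlogθ hm0
    have hB : (3 / 4 : ℝ) * ((y : ℝ) / Real.log y) ≤ (m : ℝ) * Real.log y - θv := by
      have := hy1; norm_num at this ⊢; linarith
    have hC' : (m : ℝ) ≤ 2 * ((y : ℝ) / Real.log y) := by
      have := hy3.2; norm_num at this ⊢; linarith
    have hyl : 0 ≤ (y : ℝ) / Real.log y := by positivity
    have hhalf : (y : ℝ) / (2 * Real.log y) = (1 / 2) * ((y : ℝ) / Real.log y) := by
      field_simp
    rw [hhalf]
    nlinarith [hA, hB, hC', hyl]
  -- the left-hand side in logarithmic form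
  have hx1 : (primorial y : ℝ) + 1 ≤ 2 * (primorial y : ℝ) := by
    have : (1 : ℝ) ≤ (primorial y : ℝ) := by exact_mod_cast primorial_pos y
    linarith
  have hsqθ0 : 0 ≤ Real.sqrt θv := Real.sqrt_nonneg _
  have hlogθ0 : 0 ≤ Real.log θv := Real.log_nonneg hθ1
  have hsqrt_le : Real.sqrt θv ≤ Real.sqrt (2 * y) := Real.sqrt_le_sqrt hθ2y
  have hlog_le : Real.log θv ≤ Real.log (2 * y) := Real.log_le_log hθ0 hθ2y
  have hexpo : C * Real.sqrt θv * Real.log θv ≤ K * Real.sqrt (2 * y) * Real.log (2 * y) := by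
    calc C * Real.sqrt θv * Real.log θv = C * (Real.sqrt θv * Real.log θv) := by ring
      _ ≤ K * (Real.sqrt θv * Real.log θv) := mul_le_mul_of_nonneg_right hCK (by positivity)
      _ ≤ K * (Real.sqrt (2 * y) * Real.log (2 * y)) :=
          mul_le_mul_of_nonneg_left (mul_le_mul hsqrt_le hlog_le hlogθ0 (Real.sqrt_nonneg _)) hK0
      _ = K * Real.sqrt (2 * y) * Real.log (2 * y) := by ring
  have hkey : Real.log (((primorial y : ℝ) + 1) * Real.exp (C * Real.sqrt θv * Real.log θv)) <
      (m : ℝ) * Real.log θv := by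
    rw [Real.log_mul (by positivity) (Real.exp_pos _).ne', Real.log_exp]
    have hl : Real.log ((primorial y : ℝ) + 1) ≤ Real.log 2 + θv := by
      calc Real.log ((primorial y : ℝ) + 1) ≤ Real.log (2 * (primorial y : ℝ)) :=
            Real.log_le_log (by positivity) hx1
        _ = Real.log 2 + θv := by rw [Real.log_mul two_ne_zero hx0.ne', hθx]
    linarith [hy4]
  refine ⟨?_, by rw [hθx]; exact hθ1, ?_⟩
  · -- `3 ≤ primorial y` from `log x = θ ≥ 15 > log 3`
    have hlog3 : Real.log 3 ≤ θv := by
      have := Real.log_le_sub_one_of_pos (show (0 : ℝ) < 3 by norm_num); linarith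
    have h3 : (3 : ℝ) ≤ (primorial y : ℝ) := by
      rw [← Real.log_le_log_iff (by norm_num) hx0, hθx]; exact hlog3
    exact_mod_cast h3
  · rw [hθx, pow_mul, Real.sq_sqrt hθ0.le]
    have hpos : 0 < ((primorial y : ℝ) + 1) * Real.exp (C * Real.sqrt θv * Real.log θv) := by positivity
    rw [← Real.log_lt_log_iff hpos (pow_pos hθ0 m), Real.log_pow]
    exact hkey

/-! ## The capped statistic at a squarefree point -/

/-- For squarefree `n`, `Σ_p min(v_p(n), 2) = ω(n)`. [folklore] -/
theorem capped_eq_card_of_squarefree {n : ℕ} (hn : Squarefree n) :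
    (n.factorization.sum fun _ v => min v 2) = n.primeFactors.card := by
  rw [Finsupp.sum, Nat.support_factorization, Finset.card_eq_sum_ones]
  refine Finset.sum_congr rfl fun p hp => ?_
  have h1 : 0 < n.factorization p := by
    obtain ⟨hp', hpn, hn0⟩ := Nat.mem_primeFactors.1 hp
    exact hp'.factorization_pos_of_dvd hn0 hpn
  have h2 : n.factorization p ≤ 1 := hn.natFactorization_le_one p
  omega

/-- `ω(primorial y) = π(y)`. [folklore] -/
theorem card_primeFactors_primorial (y : ℕ) : (primorial y).primeFactors.card = Nat.primeCounting y := by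
  rw [primeFactors_primorial, Nat.primesLE_card_eq_primeCounting]

/-! ## (a) `irreducible` is load-bearing — witness `![X ^ 2]` -/

/-- DROP `irreducible` ⇒ S1 is FALSE. Witness `k = 1`, `f = ![X²]` (leading coefficient `1 > 0`, `ω(p) = 1 < p`,
pairwise condition vacuous): `s(n²) = 2ω(n)`, and at `x = primorial y`, `t = √log x` the single term `n = x` is
`(log x)^{π(y)} > (x+1)e^{C t log log x}` (`primorial_witness`). [folklore] -/
theorem stubFarMoment_false_without_irreducible :
    ¬ ∀ (k : ℕ) (f : Fin k → ℤ[X]), (∀ i, 0 < (f i).leadingCoeff) →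
      (Pairwise fun i j => ¬Associated (f i) (f j)) → HasNoFixedPrimeDivisor f →
      ∃ C : ℝ, ∀ x : ℕ, 3 ≤ x → ∀ t : ℝ, 1 ≤ t → t ≤ Real.sqrt (Real.log (x : ℝ)) →
        (∑ n ∈ Finset.range (x + 1), (t : ℝ) ^ (∑ i, (((f i).eval (n : ℤ)).toNat.factorization.sum
          fun _ v => min v 2))) ≤ ((x : ℝ) + 1) * Real.exp (C * t * Real.log (Real.log (x : ℝ))) := by
  intro h
  obtain ⟨C, hC⟩ := h 1 ![X ^ 2] (fun i => by simp) Subsingleton.pairwise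
    (fun p hp => by rw [polyRootCountMod_eq_one sq_dvd_iff hp]; exact hp.one_lt)
  obtain ⟨y, hx3, hlog1, hlt⟩ := primorial_witness C
  have ht1 : 1 ≤ Real.sqrt (Real.log (primorial y : ℝ)) := Real.one_le_sqrt.2 hlog1
  have hCx := hC (primorial y) hx3 _ ht1 le_rfl
  have hterm : Real.sqrt (Real.log (primorial y : ℝ)) ^ (2 * Nat.primeCounting y) ≤
      ∑ n ∈ Finset.range (primorial y + 1), Real.sqrt (Real.log (primorial y : ℝ)) ^
        (∑ i, ((((![X ^ 2] : Fin 1 → ℤ[X]) i).eval (n : ℤ)).toNat.factorization.sum fun _ v => min v 2)) := by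
    have hmem : primorial y ∈ Finset.range (primorial y + 1) := Finset.mem_range.2 (Nat.lt_succ_self _)
    refine le_trans (le_of_eq ?_) (Finset.single_le_sum (f := fun n : ℕ => Real.sqrt (Real.log (primorial y : ℝ)) ^
        (∑ i, ((((![X ^ 2] : Fin 1 → ℤ[X]) i).eval (n : ℤ)).toNat.factorization.sum fun _ v => min v 2)))
      (fun n _ => by positivity) hmem)
    simp only [stat_sq, card_primeFactors_primorial]
  exact lt_irrefl _ ((hterm.trans hCx).trans_lt hlt)

/-! ## (b) `pairwise_not_associated` is load-bearing — witness `![X, X]` -/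

/-- DROP `pairwise_not_associated` ⇒ S1 is FALSE. Witness `k = 2`, `f = ![X, X]` (both irreducible, leading
coefficients `1`, `ω(p) = 1 < p`): `s_f(n) = 2 s(n)`, and `s(primorial y) = ω(primorial y) = π(y)` (squarefree), so
again the single term `n = x = primorial y` at `t = √log x` is `(log x)^{π(y)} > (x+1)e^{C t log log x}`. [folklore] -/
theorem stubFarMoment_false_without_pairwise_not_associated :
    ¬ ∀ (k : ℕ) (f : Fin k → ℤ[X]), (∀ i, Irreducible (f i)) → (∀ i, 0 < (f i).leadingCoeff) →
      HasNoFixedPrimeDivisor f →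
      ∃ C : ℝ, ∀ x : ℕ, 3 ≤ x → ∀ t : ℝ, 1 ≤ t → t ≤ Real.sqrt (Real.log (x : ℝ)) →
        (∑ n ∈ Finset.range (x + 1), (t : ℝ) ^ (∑ i, (((f i).eval (n : ℤ)).toNat.factorization.sum
          fun _ v => min v 2))) ≤ ((x : ℝ) + 1) * Real.exp (C * t * Real.log (Real.log (x : ℝ))) := by
  intro h
  obtain ⟨C, hC⟩ := h 2 ![X, X]
    (fun i => by fin_cases i <;> simpa using Polynomial.prime_X.irreducible)
    (fun i => by fin_cases i <;> simp)
    (fun p hp => by rw [polyRootCountMod_eq_one pair_dvd_iff hp]; exact hp.one_lt)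
  obtain ⟨y, hx3, hlog1, hlt⟩ := primorial_witness C
  have ht1 : 1 ≤ Real.sqrt (Real.log (primorial y : ℝ)) := Real.one_le_sqrt.2 hlog1
  have hCx := hC (primorial y) hx3 _ ht1 le_rfl
  have hterm : Real.sqrt (Real.log (primorial y : ℝ)) ^ (2 * Nat.primeCounting y) ≤
      ∑ n ∈ Finset.range (primorial y + 1), Real.sqrt (Real.log (primorial y : ℝ)) ^
        (∑ i, ((((![X, X] : Fin 2 → ℤ[X]) i).eval (n : ℤ)).toNat.factorization.sum fun _ v => min v 2)) := by
    have hmem : primorial y ∈ Finset.range (primorial y + 1) := Finset.mem_range.2 (Nat.lt_succ_self _)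
    refine le_trans (le_of_eq ?_) (Finset.single_le_sum (f := fun n : ℕ => Real.sqrt (Real.log (primorial y : ℝ)) ^
        (∑ i, ((((![X, X] : Fin 2 → ℤ[X]) i).eval (n : ℤ)).toNat.factorization.sum fun _ v => min v 2)))
      (fun n _ => by positivity) hmem)
    simp only [stat_pair, capped_eq_card_of_squarefree (squarefree_primorial y), card_primeFactors_primorial]
  exact lt_irrefl _ ((hterm.trans hCx).trans_lt hlt)

end Summit.Parity.BatemanHorn.Theorems.SystemZeroRepulsion.Negative
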